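/-
Copyright (c) 2026 the pub-hodgecm-mathlib formalisation cell (harness21).  Prover seat hodgecm-mathlib-K2E3-p26 (g0), Track B «K2-LIT» ∕ h413
(`stmt-HodgeConjecture-24833`), line `K2_E3_EllipticInputs`, unit U4 «Keys», cell «U4-RAM» (dealer K2E3-plan (g4) L4∕E3 EMIT #5), PART «U4Keys» socket :155
`sig_K2E3KeysThmTwoContractingRamifiedCharOneDepthZeroNormTrivial` (depth 0, Branch B), plan step Z3-a (cell functions), PLACE-MODEL GEOMETRY.  2026-09-04.
-/
import Summits.HodgeConjecture.HodgeConjecture.Theorems.K2E3LowerUnipotentBorelIwahori   -- ★ Z2A-3a (K2E3-p06 (g4)): the place-model frame `(σ ϖ J hJ hσ hvσ hvϖ g₁ hg₁)`, Iwahori `I = K₀ ⊓ K₁`; brings ★ Iwahori test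
import Literature.NumberTheory.Automorphic.UnitaryGroupRankOneBigCell                   -- ★ `exists_coe_eq_lower`, `coe_coe_weylLongU_three`, `weylLongU_mul_weylLongU`, `v_mul_v_le_of_rel`, `v_le_one_of_rel`, `v_le_v_of_rel`
import HarnessLib

/-!
# K2 ∕ E3 «EllipticInputs», unit U4 «Keys» — socket :155 (depth 0, Branch B), step Z3-a, PLACE MODEL: THE CELL GEOMETRY OF `w₀ · u(x, z)` AND `w₀ · u(x, z) · w₀` AGAINST
# `G = B·I ⊔ B·w₀·I` — explicit factorisations `w₀ u = p κ`, `w₀ u w₀ = p w₀ n₂` with `p ∈ B`, `κ, n₂ ∈ I`, and the exact regions `u ∈ I ⟺ |z| ≤ 1`, `w₀uw₀ ∈ I ⟺ |z| < 1`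

Cell hodgecm-mathlib (D-0151), FLOOR 0, Track B «K2-LIT», engine E3, crux item H413 = stmt-HodgeConjecture-24833 (route `HCCMUnconditional`, no route verbs); target BY NAME the
OPEN socket `…U4Keys.sig_K2E3KeysThmTwoContractingRamifiedCharOneDepthZeroNormTrivial` (:155; Keys §7 Thm. (2), ramified `χ₁` of depth 0 with `χ₁ ∘ N = 1` on units = BRANCH B of
design D-I v2 of K2E3-p06 (g4)), plan step Z3-a «the cell functions of the type basis `f₁, f_w` on `w₀N` and on `N̄`» (`PAPER-Z3-DepthZeroInert` §0), its GROUP-THEORETIC half.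
Author K2E3-p26 (g0) (second hand of cell «U4-RAM», co-hand K2E3-p32 (g0)).  `--supports stmt-HodgeConjecture-24833 --as helper`; THEOREMS ONLY (no `def`, no `instance`, no
notation, no named-fact hypothesis, no `sorry`).  NOT THE PAYER.

THE POINT.  The Casselman pair `Λ_g(φ) = ∫_N φ(w₀ n g) dn` (`g ∈ {1, w₀}`) of an `(I, χ̃)`-eigen-section `φ` of `i(χ)` is computed from the values of `φ` on the two cells
`B·I`, `B·w₀·I` (★ Z2-gen `K2E3TypeVectorSupport.toFun_mul_eq_of_eigen`: `φ(p κ) = τ(p) χ̃(κ) φ(1)`; ★ Z2 `K2E3IwahoriPlaneTwoCells.toFun_mul_mul_eq_of_eigen`: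
`φ(p w₀ κ) = τ(p) χ̃(κ) φ(w₀)`).  THIS FILE supplies, over a valued field `K` with an isometric involution `σ` and a uniformiser `ϖ` (the place model of ★ Road II, ANY residue
characteristic), for `n = u(x, z) ∈ N` (`z + σz + xσx = 0`): WHICH cell `w₀ n` and `w₀ n w₀` lie in, and the EXPLICIT factors — so that `τ(p)` is read off the diagonal
`((σz)⁻¹, −σz∕z, z)` of `p` and `χ̃(κ) = χ₁(κ₀₀) = χ₁(1) = 1`:
* §1 `mem_inf_iff_of_coe_eq_upper` — `u(x, z) ∈ I ⟺ |x| ≤ 1 ∧ |z| ≤ 1` (★ Iwahori test), `⟺ |z| ≤ 1` given the relation (`|x|² ≤ |z|`): the region `N₀ = N ∩ I = N(𝒪)`; there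
  `w₀ n = 1 · w₀ · n` is already in the cell `B·w₀·I`.
* §2 **`exists_weylLongU_mul_eq`** — for `z ≠ 0`: `w₀ · u(x,z) = p · κ` with `p = [[(σz)⁻¹, −x∕z, 1], [0, −σz∕z, −σx], [0, 0, z]] ∈ B` and `κ = ū(x∕z, 1∕z) =
  [[1,0,0],[−σx∕σz,1,0],[1∕z,x∕z,1]]` (the rank-one BIG CELL, cf. ★ `upper_eq_lower_mul_diag_mul_weyl_mul_lower`); **`lower_mem_inf_of_one_lt_v`** — `κ ∈ I` when `|z| > 1`
  (`|x∕z| ≤ |z|^{−1∕2} < 1`, `|1∕z| < 1`): the region `N ∖ N₀`, cell `B·I`.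
* §3 **`exists_weylLongU_mul_mul_weylLongU_eq`** — for `z ≠ 0`: `w₀ · u(x,z) · w₀ = p · w₀ · n₂` with the same `p` and `n₂ = w₀ κ w₀ = u(x∕z, 1∕z) ∈ N`; `n₂ ∈ I` when `|z| ≥ 1`
  (§1): the region `{|z| ≥ 1}` of `N̄ = w₀Nw₀`, cell `B·w₀·I`.
* §4 `coe_weylLongU_mul_mul_weylLongU`, **`weylLongU_mul_mul_weylLongU_mem_inf_iff`** — `w₀ u(x,z) w₀ = ū(x, z) = [[1,0,0],[−σx,1,0],[z,x,1]]`, and `ū(x,z) ∈ I ⟺ |z| < 1`: the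
  region `N̄₁ = N̄ ∩ I`, cell `B·I` with `p = 1`.
Consumers: Z3-a CM half (transport along `eA` of ★ Z2A-3b∕c: `symm_mem_P_of_mem_borelU`, `symm_mem_of_mem_inf`, `map_weyl_eq_weylLongU`) giving the four integrands
`f_w(w₀u) = 𝟙_{N₀}`, `f₁(w₀u) = 𝟙_{N∖N₀}·χ₁(σz)⁻¹‖z‖⁻¹`, `f₁(w₀uw₀) = 𝟙_{|z|<1}`, `f_w(w₀uw₀) = 𝟙_{|z|≥1}·χ₁(σz)⁻¹‖z‖⁻¹` of `PAPER-Z3` §0, then Z3-c (shell integrals).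

HONEST LABEL: HC_CM is proved only modulo the 7 printed citations (2 remaining named inputs: hLiu418 = stmt-HodgeConjecture-24832, h413 = stmt-HodgeConjecture-24833)
until rung 0 closes; count-neutral — this file does NOT pay the socket; no printed citation is discharged.

## References
* [BruhatTits1972] F. Bruhat, J. Tits, *Groupes réductifs sur un corps local I*, Publ. Math. IHÉS 41 (1972), (4.4.3)–(4.4.4) (Iwahori subgroup and the affine cells of a rank-one group).
* [Casselman1995] W. Casselman, *Introduction to the theory of admissible representations of `p`-adic reductive groups* (1995), Prop. 1.3.1 (rank-one Bruhat cells), §6.4.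
* [Rogawski1990] J. Rogawski, *Automorphic representations of unitary groups in three variables*, Ann. of Math. Stud. 123 (1990), §1.10 p. 9 (`B = TN`, `N̄`, `w`, `u(x,z)`).
* [Keys1984] D. Keys, *Principal series representations of special unitary groups over local fields*, Compositio Math. 51 (1984), §7 (the intertwining integrals on the big cell).
-/

set_option autoImplicit false
-- the mandated namespace has the single-problem summit's repeated segment (`HodgeConjecture.HodgeConjecture`)
set_option linter.dupNamespace false

noncomputable section

open Matrix Literature.NumberTheory.Automorphic Literature.NumberTheory.Automorphic.UnitaryGroup
open scoped Matrix MatrixGroups WithZero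

namespace Summit.HodgeConjecture.HodgeConjecture.Cruxes.H413.K2E3BranchBCellGeometry

variable {K : Type*} [Field K] [Valued K ℤᵐ⁰] [ValuativeRel K] [(Valued.v : Valuation K ℤᵐ⁰).Compatible]
  (σ : K →+* K) {ϖ : K} {J : Matrix (Fin 3) (Fin 3) K} (hJ : J = (StdForm.antidiagonal 3).over K)
  (hσ : ∀ a, σ (σ a) = a) (hvσ : ∀ a, Valued.v (σ a) = Valued.v a) (hvϖ : Valued.v ϖ = WithZero.exp (-1 : ℤ))
  (g₁ : GL (Fin 3) K) (hg₁ : (g₁ : Matrix (Fin 3) (Fin 3) K) = Matrix.diagonal ![(1 : K), 1, ϖ])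

/-! ## §0 Two valuation inequalities on `N` -/

omit [ValuativeRel K] [(Valued.v : Valuation K ℤᵐ⁰).Compatible] in
/-- On `N`: `|z| > 1 ⟹ |x| < |z|` (from `|x|² ≤ |z|`, ★ `v_mul_v_le_of_rel`). [cite: Rogawski1990, §1.10 p. 9] -/
theorem v_lt_v_of_rel (hvσ : ∀ a, Valued.v (σ a) = Valued.v a) {x z : K} (hrel : z + σ z + x * σ x = 0) (hz : 1 < Valued.v z) :
    Valued.v x < Valued.v z := by
  by_contra hx
  rw [not_lt] at hx
  have h1 : Valued.v z * 1 < Valued.v z * Valued.v z := mul_lt_mul_of_pos_left hz (zero_lt_one.trans hz)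
  rw [mul_one] at h1
  exact absurd ((h1.trans_le (mul_le_mul' hx hx)).trans_le (v_mul_v_le_of_rel σ hvσ hrel)) (lt_irrefl _)

omit [ValuativeRel K] [(Valued.v : Valuation K ℤᵐ⁰).Compatible] in
/-- On `N`: `|z| < 1 ⟹ |x| < 1` (from `|x|² ≤ |z|`). [cite: Rogawski1990, §1.10 p. 9] -/
theorem v_lt_one_of_rel (hvσ : ∀ a, Valued.v (σ a) = Valued.v a) {x z : K} (hrel : z + σ z + x * σ x = 0) (hz : Valued.v z < 1) :
    Valued.v x < 1 := by
  by_contra hx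
  rw [not_lt] at hx
  have h1 : (1 : ℤᵐ⁰) * 1 ≤ Valued.v x * Valued.v x := mul_le_mul' hx hx
  rw [mul_one] at h1
  exact absurd ((h1.trans (v_mul_v_le_of_rel σ hvσ hrel)).trans_lt hz) (lt_irrefl _)

/-! ## §1 `u(x, z) ∈ I ⟺ |x| ≤ 1 ∧ |z| ≤ 1` -/

include hJ hvσ hvϖ hg₁ in
/-- **`u(x, z) ∈ I ⟺ |x| ≤ 1 ∧ |z| ≤ 1`** (★ Iwahori test `mem_glInt_inf_conj_glInt_iff`: integral entries, and the three strictly lower entries of an upper unitriangular matrix vanish).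
[cite: BruhatTits1972, (4.4.4)] [cite: Rogawski1990, §1.10 p. 9] -/
theorem mem_inf_iff_of_coe_eq_upper {n : ↥(unitaryGroupOfForm σ J)} {x z : K}
    (hn : ((n : GL (Fin 3) K) : Matrix (Fin 3) (Fin 3) K) = !![1, x, z; 0, 1, -σ x; 0, 0, 1]) :
    n ∈ (glInt 3 K).subgroupOf (unitaryGroupOfForm σ J) ⊓ ((glInt 3 K).map (MulAut.conj g₁).toMonoidHom).subgroupOf (unitaryGroupOfForm σ J) ↔
      Valued.v x ≤ 1 ∧ Valued.v z ≤ 1 := by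
  rw [mem_glInt_inf_conj_glInt_iff σ hJ hvσ hvϖ g₁ hg₁ n, hn]
  constructor
  · rintro ⟨hall, -, -, -⟩
    exact ⟨by simpa using hall 0 1, by simpa using hall 0 2⟩
  · rintro ⟨hx, hz⟩
    refine ⟨fun i j => ?_, by simp, by simp, by simp⟩
    fin_cases i <;> fin_cases j <;> simp [Valuation.map_neg, hvσ, hx, hz]

include hJ hvσ hvϖ hg₁ in
/-- **`u(x, z) ∈ I ⟺ |z| ≤ 1`** for `u(x,z) ∈ N` (`z + σz + xσx = 0`, so `|x|² ≤ |z|`, ★ `v_le_one_of_rel`): the region `N₀ = N ∩ I`. [cite: BruhatTits1972, (4.4.4)] [cite: Rogawski1990, §1.10 p. 9] -/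
theorem mem_inf_iff_v_le_one {n : ↥(unitaryGroupOfForm σ J)} {x z : K}
    (hn : ((n : GL (Fin 3) K) : Matrix (Fin 3) (Fin 3) K) = !![1, x, z; 0, 1, -σ x; 0, 0, 1]) (hrel : z + σ z + x * σ x = 0) :
    n ∈ (glInt 3 K).subgroupOf (unitaryGroupOfForm σ J) ⊓ ((glInt 3 K).map (MulAut.conj g₁).toMonoidHom).subgroupOf (unitaryGroupOfForm σ J) ↔
      Valued.v z ≤ 1 := by
  rw [mem_inf_iff_of_coe_eq_upper σ hJ hvσ hvϖ g₁ hg₁ hn]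
  exact ⟨And.right, fun hz => ⟨v_le_one_of_rel σ hvσ hrel hz, hz⟩⟩

/-! ## §2 The big cell: `w₀ · u(x, z) = p · κ` -/

include hJ hσ in
omit [Valued K ℤᵐ⁰] [ValuativeRel K] [(Valued.v : Valuation K ℤᵐ⁰).Compatible] in
/-- **THE BIG CELL, `w₀ · u(x, z) = p · κ`** (`z ≠ 0`, `z + σz + xσx = 0`): `p = [[(σz)⁻¹, −x∕z, 1], [0, −σz∕z, −σx], [0, 0, z]]` (upper triangular, diagonal `((σz)⁻¹, −σz∕z, z)`) and
`κ = ū(x∕z, 1∕z) = [[1, 0, 0], [−σx∕σz, 1, 0], [1∕z, x∕z, 1]]` (lower unitriangular, ★ `exists_coe_eq_lower`) — the rank-one big-cell identity ★ `upper_eq_lower_mul_diag_mul_weyl_mul_lower`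
multiplied by `w₀` on the left. [cite: Rogawski1990, §1.10 p. 9] [cite: Casselman1995, Prop. 1.3.1] [cite: Keys1984, §7] -/
theorem exists_weylLongU_mul_eq {n : ↥(unitaryGroupOfForm σ J)} {x z : K}
    (hn : ((n : GL (Fin 3) K) : Matrix (Fin 3) (Fin 3) K) = !![1, x, z; 0, 1, -σ x; 0, 0, 1]) (hrel : z + σ z + x * σ x = 0) (hz : z ≠ 0) :
    ∃ p κ : ↥(unitaryGroupOfForm σ J), weylLongU σ hJ * n = p * κ ∧
      ((p : GL (Fin 3) K) : Matrix (Fin 3) (Fin 3) K) = !![(σ z)⁻¹, -(x * z⁻¹), 1; 0, -(σ z * z⁻¹), -σ x; 0, 0, z] ∧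
      ((κ : GL (Fin 3) K) : Matrix (Fin 3) (Fin 3) K) = !![1, 0, 0; -(σ x * (σ z)⁻¹), 1, 0; z⁻¹, x * z⁻¹, 1] := by
  have hσz : σ z ≠ 0 := (map_ne_zero σ).2 hz
  -- the lower factor `κ = ū(x∕z, 1∕z)`
  have hrel' : z⁻¹ + σ z⁻¹ + x * z⁻¹ * σ (x * z⁻¹) = 0 := by
    rw [map_inv₀, map_mul, map_inv₀]
    have : z⁻¹ + (σ z)⁻¹ + x * z⁻¹ * (σ x * (σ z)⁻¹) = (z * σ z)⁻¹ * (z + σ z + x * σ x) := by field_simp; ring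
    rw [this, hrel, mul_zero]
  obtain ⟨κ, hκ⟩ := exists_coe_eq_lower σ hJ hσ hrel'
  rw [map_mul, map_inv₀] at hκ
  -- the matrices `P`, `W`, `U`, `K`
  set P : Matrix (Fin 3) (Fin 3) K := !![(σ z)⁻¹, -(x * z⁻¹), 1; 0, -(σ z * z⁻¹), -σ x; 0, 0, z] with hP
  have hW := coe_coe_weylLongU_three σ hJ
  -- `P · K = W · U` (two entries use the relation)
  have hPK : P * ((κ : GL (Fin 3) K) : Matrix (Fin 3) (Fin 3) K) =
      (((weylLongU σ hJ : ↥(unitaryGroupOfForm σ J)) : GL (Fin 3) K) : Matrix (Fin 3) (Fin 3) K) * ((n : GL (Fin 3) K) : Matrix (Fin 3) (Fin 3) K) := by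
    rw [hκ, hW, hn, hP]
    ext i j
    fin_cases i <;> fin_cases j <;> simp [Matrix.mul_apply, Fin.sum_univ_three] <;> field_simp <;>
      first | ring1 | linear_combination hrel | linear_combination -hrel
  refine ⟨weylLongU σ hJ * n * κ⁻¹, κ, by rw [inv_mul_cancel_right], ?_, hκ⟩
  -- `↑↑(w n κ⁻¹) = W U K⁻¹ = P K K⁻¹ = P`
  rw [Subgroup.coe_mul, Subgroup.coe_mul, Subgroup.coe_inv, Units.val_mul, Units.val_mul, ← hPK, Matrix.mul_assoc, ← Units.val_mul, mul_inv_cancel,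
    Units.val_one, Matrix.mul_one]

omit [Valued K ℤᵐ⁰] [ValuativeRel K] [(Valued.v : Valuation K ℤᵐ⁰).Compatible] in
/-- The factor `p` of §2 lies in the Borel subgroup `B` (it is upper triangular). [cite: Rogawski1990, §1.10 p. 9] -/
theorem mem_borelU_of_coe_eq {p : ↥(unitaryGroupOfForm σ J)} {x z : K}
    (hp : ((p : GL (Fin 3) K) : Matrix (Fin 3) (Fin 3) K) = !![(σ z)⁻¹, -(x * z⁻¹), 1; 0, -(σ z * z⁻¹), -σ x; 0, 0, z]) :
    p ∈ borelU σ J := by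
  rw [mem_borelU_iff, hp]
  intro i j hij
  fin_cases i <;> fin_cases j <;> simp_all

include hJ hvσ hvϖ hg₁ in
/-- **`κ = ū(x∕z, 1∕z) ∈ I` when `|z| > 1`**: its entries are integral and its strictly lower entries `−σx∕σz`, `1∕z`, `x∕z` have valuation `< 1` (`|x| < |z|` on `N` far out, §0); so for
`u(x,z) ∉ N₀` the element `w₀ u(x,z)` lies in the cell `B·I`. [cite: BruhatTits1972, (4.4.4)] [cite: Casselman1995, Prop. 1.3.1] -/
theorem lower_mem_inf_of_one_lt_v {κ : ↥(unitaryGroupOfForm σ J)} {x z : K}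
    (hκ : ((κ : GL (Fin 3) K) : Matrix (Fin 3) (Fin 3) K) = !![1, 0, 0; -(σ x * (σ z)⁻¹), 1, 0; z⁻¹, x * z⁻¹, 1]) (hrel : z + σ z + x * σ x = 0)
    (hz : 1 < Valued.v z) :
    κ ∈ (glInt 3 K).subgroupOf (unitaryGroupOfForm σ J) ⊓ ((glInt 3 K).map (MulAut.conj g₁).toMonoidHom).subgroupOf (unitaryGroupOfForm σ J) := by
  have hz0 : Valued.v z ≠ 0 := (zero_lt_one.trans hz).ne'
  have hxz : Valued.v (x * z⁻¹) < 1 := by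
    rw [map_mul, map_inv₀]
    calc Valued.v x * (Valued.v z)⁻¹ < Valued.v z * (Valued.v z)⁻¹ := mul_lt_mul_of_pos_right (v_lt_v_of_rel σ hvσ hrel hz) (inv_pos.2 (zero_lt_one.trans hz))
      _ = 1 := mul_inv_cancel₀ hz0
  have hσxz : Valued.v (-(σ x * (σ z)⁻¹)) < 1 := by
    rw [Valuation.map_neg, ← map_inv₀, ← map_mul, hvσ]; exact hxz
  have hzinv : Valued.v z⁻¹ < 1 := by rw [map_inv₀]; exact inv_lt_one_of_one_lt₀ hz
  have hxz' : Valued.v x * (Valued.v z)⁻¹ ≤ 1 := by rw [← map_inv₀, ← map_mul]; exact hxz.le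
  have hzinv' : (Valued.v z)⁻¹ ≤ 1 := by rw [← map_inv₀]; exact hzinv.le
  rw [mem_glInt_inf_conj_glInt_iff σ hJ hvσ hvϖ g₁ hg₁ κ, hκ]
  refine ⟨fun i j => ?_, by simpa using hzinv, by simpa using hxz, by simpa using hσxz⟩
  fin_cases i <;> fin_cases j <;> simp [hvσ, hxz', hzinv']

/-! ## §3 `w₀ · u(x, z) · w₀ = p · w₀ · n₂` with `n₂ = u(x∕z, 1∕z)` -/

include hJ in
omit [Valued K ℤᵐ⁰] [ValuativeRel K] [(Valued.v : Valuation K ℤᵐ⁰).Compatible] in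
/-- **`w₀ κ w₀ = u(x∕z, 1∕z)`** for `κ = ū(x∕z, 1∕z)` (conjugation by `w₀ = antidiag(1,1,1)` reverses rows and columns). [cite: Rogawski1990, §1.10 p. 9] -/
theorem coe_weylLongU_mul_lower_mul_weylLongU {κ : ↥(unitaryGroupOfForm σ J)} {x z : K}
    (hκ : ((κ : GL (Fin 3) K) : Matrix (Fin 3) (Fin 3) K) = !![1, 0, 0; -(σ x * (σ z)⁻¹), 1, 0; z⁻¹, x * z⁻¹, 1]) :
    (((weylLongU σ hJ * κ * weylLongU σ hJ : ↥(unitaryGroupOfForm σ J)) : GL (Fin 3) K) : Matrix (Fin 3) (Fin 3) K) =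
      !![1, x * z⁻¹, z⁻¹; 0, 1, -(σ x * (σ z)⁻¹); 0, 0, 1] := by
  rw [Subgroup.coe_mul, Subgroup.coe_mul, Units.val_mul, Units.val_mul, coe_coe_weylLongU_three σ hJ, hκ]
  ext i j
  fin_cases i <;> fin_cases j <;> simp [Matrix.mul_apply, Fin.sum_univ_three]

include hJ hσ in
omit [Valued K ℤᵐ⁰] [ValuativeRel K] [(Valued.v : Valuation K ℤᵐ⁰).Compatible] in
/-- **`w₀ · u(x, z) · w₀ = p · w₀ · n₂`** (`z ≠ 0`) with `p` as in §2 and `n₂ = u(x∕z, 1∕z) ∈ N` (`= w₀ κ w₀`; `w₀² = 1`): the lower unipotent `w₀uw₀ ∈ N̄` read in the cell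
`B·w₀·I` whenever `n₂ ∈ I`, i.e. `|z| ≥ 1` (§1). [cite: Rogawski1990, §1.10 p. 9] [cite: Casselman1995, Prop. 1.3.1] [cite: Keys1984, §7] -/
theorem exists_weylLongU_mul_mul_weylLongU_eq {n : ↥(unitaryGroupOfForm σ J)} {x z : K}
    (hn : ((n : GL (Fin 3) K) : Matrix (Fin 3) (Fin 3) K) = !![1, x, z; 0, 1, -σ x; 0, 0, 1]) (hrel : z + σ z + x * σ x = 0) (hz : z ≠ 0) :
    ∃ p n₂ : ↥(unitaryGroupOfForm σ J), weylLongU σ hJ * n * weylLongU σ hJ = p * weylLongU σ hJ * n₂ ∧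
      ((p : GL (Fin 3) K) : Matrix (Fin 3) (Fin 3) K) = !![(σ z)⁻¹, -(x * z⁻¹), 1; 0, -(σ z * z⁻¹), -σ x; 0, 0, z] ∧
      ((n₂ : GL (Fin 3) K) : Matrix (Fin 3) (Fin 3) K) = !![1, x * z⁻¹, z⁻¹; 0, 1, -(σ x * (σ z)⁻¹); 0, 0, 1] := by
  obtain ⟨p, κ, hfac, hp, hκ⟩ := exists_weylLongU_mul_eq σ hJ hσ hn hrel hz
  refine ⟨p, weylLongU σ hJ * κ * weylLongU σ hJ, ?_, hp, coe_weylLongU_mul_lower_mul_weylLongU σ hJ hκ⟩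
  have hww := weylLongU_mul_weylLongU σ hJ
  calc weylLongU σ hJ * n * weylLongU σ hJ = p * κ * weylLongU σ hJ := by rw [hfac]
    _ = p * (weylLongU σ hJ * weylLongU σ hJ) * κ * weylLongU σ hJ := by rw [hww, mul_one]
    _ = p * weylLongU σ hJ * (weylLongU σ hJ * κ * weylLongU σ hJ) := by simp only [mul_assoc]

include hJ hvσ hvϖ hg₁ in
/-- **`n₂ = u(x∕z, 1∕z) ∈ I` when `|z| ≥ 1`** (§1 with `|x∕z| ≤ 1`, `|1∕z| ≤ 1`; `|x| ≤ |z|` on `N` for `|z| ≥ 1`). [cite: BruhatTits1972, (4.4.4)] [cite: Rogawski1990, §1.10 p. 9] -/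
theorem upper_mem_inf_of_one_le_v {n₂ : ↥(unitaryGroupOfForm σ J)} {x z : K}
    (hn₂ : ((n₂ : GL (Fin 3) K) : Matrix (Fin 3) (Fin 3) K) = !![1, x * z⁻¹, z⁻¹; 0, 1, -(σ x * (σ z)⁻¹); 0, 0, 1]) (hrel : z + σ z + x * σ x = 0)
    (hz : 1 ≤ Valued.v z) :
    n₂ ∈ (glInt 3 K).subgroupOf (unitaryGroupOfForm σ J) ⊓ ((glInt 3 K).map (MulAut.conj g₁).toMonoidHom).subgroupOf (unitaryGroupOfForm σ J) := by
  have hz0 : Valued.v z ≠ 0 := (zero_lt_one.trans_le hz).ne'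
  have hxz' : Valued.v x ≤ Valued.v z := by
    rcases hz.lt_or_eq with hlt | heq
    · exact (v_lt_v_of_rel σ hvσ hrel hlt).le
    · rw [← heq]; exact v_le_one_of_rel σ hvσ hrel heq.symm.le
  have hxz : Valued.v (x * z⁻¹) ≤ 1 := by
    rw [map_mul, map_inv₀]
    calc Valued.v x * (Valued.v z)⁻¹ ≤ Valued.v z * (Valued.v z)⁻¹ := mul_le_mul' hxz' le_rfl
      _ = 1 := mul_inv_cancel₀ hz0
  have hzinv : Valued.v z⁻¹ ≤ 1 := by rw [map_inv₀]; exact inv_le_one_of_one_le₀ hz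
  have hn₂' : ((n₂ : GL (Fin 3) K) : Matrix (Fin 3) (Fin 3) K) = !![1, x * z⁻¹, z⁻¹; 0, 1, -σ (x * z⁻¹); 0, 0, 1] := by
    rw [hn₂, map_mul, map_inv₀]
  exact (mem_inf_iff_of_coe_eq_upper σ hJ hvσ hvϖ g₁ hg₁ hn₂').2 ⟨hxz, hzinv⟩

/-! ## §4 `w₀ · u(x, z) · w₀ = ū(x, z)` and `ū(x, z) ∈ I ⟺ |z| < 1` -/

include hJ in
omit [Valued K ℤᵐ⁰] [ValuativeRel K] [(Valued.v : Valuation K ℤᵐ⁰).Compatible] in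
/-- **`w₀ · u(x, z) · w₀ = ū(x, z) = [[1,0,0],[−σx,1,0],[z,x,1]]`** (rows and columns reversed; cf. ★ Z2A-3a `exists_coe_eq_lower_of_mem_map`). [cite: Rogawski1990, §1.10 p. 9] -/
theorem coe_weylLongU_mul_mul_weylLongU {n : ↥(unitaryGroupOfForm σ J)} {x z : K}
    (hn : ((n : GL (Fin 3) K) : Matrix (Fin 3) (Fin 3) K) = !![1, x, z; 0, 1, -σ x; 0, 0, 1]) :
    (((weylLongU σ hJ * n * weylLongU σ hJ : ↥(unitaryGroupOfForm σ J)) : GL (Fin 3) K) : Matrix (Fin 3) (Fin 3) K) = !![1, 0, 0; -σ x, 1, 0; z, x, 1] := by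
  rw [Subgroup.coe_mul, Subgroup.coe_mul, Units.val_mul, Units.val_mul, coe_coe_weylLongU_three σ hJ, hn]
  ext i j
  fin_cases i <;> fin_cases j <;> simp [Matrix.mul_apply, Fin.sum_univ_three]

include hJ hvσ hvϖ hg₁ in
/-- **`ū(x, z) ∈ I ⟺ |z| < 1`** for `z + σz + xσx = 0` (★ Iwahori test: the strictly lower entries `−σx, z, x` must lie in `𝔭`; `|z| < 1 ⟹ |x| < 1` on `N`, §0): the region
`N̄₁ = N̄ ∩ I` of `PAPER-Z3` §0, where the lower unipotent `w₀uw₀` lies in the cell `B·I` with `p = 1`. [cite: BruhatTits1972, (4.4.4)] [cite: Casselman1995, Prop. 1.4.4] -/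
theorem lower_mem_inf_iff_v_lt_one {nb : ↥(unitaryGroupOfForm σ J)} {x z : K}
    (hnb : ((nb : GL (Fin 3) K) : Matrix (Fin 3) (Fin 3) K) = !![1, 0, 0; -σ x, 1, 0; z, x, 1]) (hrel : z + σ z + x * σ x = 0) :
    nb ∈ (glInt 3 K).subgroupOf (unitaryGroupOfForm σ J) ⊓ ((glInt 3 K).map (MulAut.conj g₁).toMonoidHom).subgroupOf (unitaryGroupOfForm σ J) ↔
      Valued.v z < 1 := by
  rw [mem_glInt_inf_conj_glInt_iff σ hJ hvσ hvϖ g₁ hg₁ nb, hnb]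
  constructor
  · rintro ⟨-, h20, -, -⟩
    simpa using h20
  · intro hz
    have hx : Valued.v x < 1 := v_lt_one_of_rel σ hvσ hrel hz
    have hσx : Valued.v (-σ x) < 1 := by rw [Valuation.map_neg, hvσ]; exact hx
    refine ⟨fun i j => ?_, by simpa using hz, by simpa using hx, by simpa using hσx⟩
    fin_cases i <;> fin_cases j <;> simp [hz.le, hx.le]
    · simpa using hσx.le

include hJ hvσ hvϖ hg₁ in
/-- **`w₀ · u(x, z) · w₀ ∈ I ⟺ |z| < 1`** for `u(x, z) ∈ N` — §4 assembled. [cite: BruhatTits1972, (4.4.4)] [cite: Casselman1995, Prop. 1.4.4] -/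
theorem weylLongU_mul_mul_weylLongU_mem_inf_iff {n : ↥(unitaryGroupOfForm σ J)} {x z : K}
    (hn : ((n : GL (Fin 3) K) : Matrix (Fin 3) (Fin 3) K) = !![1, x, z; 0, 1, -σ x; 0, 0, 1]) (hrel : z + σ z + x * σ x = 0) :
    weylLongU σ hJ * n * weylLongU σ hJ ∈
        (glInt 3 K).subgroupOf (unitaryGroupOfForm σ J) ⊓ ((glInt 3 K).map (MulAut.conj g₁).toMonoidHom).subgroupOf (unitaryGroupOfForm σ J) ↔
      Valued.v z < 1 :=
  lower_mem_inf_iff_v_lt_one σ hJ hvσ hvϖ g₁ hg₁ (coe_weylLongU_mul_mul_weylLongU σ hJ hn) hrel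

end Summit.HodgeConjecture.HodgeConjecture.Cruxes.H413.K2E3BranchBCellGeometry

end
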